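import Mathlib
import HarnessLib
import HarnessLib.Audit
import Summits.FinalStateConjecture.Statement
import HarnessLib.Audit.Status.Attr

/-!
Route: ConcentrationCannotWait

# Route ConcentrationCannotWait — no scale, no soliton, geometric clock — every regular vacuum
development with complete scri+ disperses (the N = 0 sector), the rest is censorship-or-collapse

It suffices to show X = X₁ ∧ X₂, realising card concentration-cannot-wait with ONE correction
(horizonless := future causally geodesically complete, not "no closed trapped surface", see Why this
line). X₁ = RegularCompleteDisperses (the card's theorem-shape, the N = 0 sector for ALL data):
every maximal vacuum Cauchy development of an admissible datum which has complete 𝓘⁺ and whose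
future-directed null and timelike geodesics are all complete settles down to Minkowski space — an N
= 0 final state decomposition of its self-determined exterior O with honest-radii exhaustive charts,
future-oriented chart time and every future-complete null ray from Σ staying in closure O (re-typed
T2 Statement, 2026-08-16); "blow-up at infinity" and vacuum breathers are struck from the list of
final states. X₂ =
GenericCensorshipOrCollapse (the complementary sector, shared frame = the Statement's own property
with the regular sector left undescribed): for TAME-Christodoulou-generic admissible data (witness
families on ONE fixed asymptotically flat end, `IsTameChristodoulouGeneric`) an MGHD exists (the
anti-vacuity conjunct, carried inside X₂ exactly as in the Statement; its input is the support item
MaximalDevelopmentExists = Choquet-Bruhat–Geroch over the repaired development structure, a vendored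
fact) and every MGHD has complete 𝓘⁺ and is EITHER future causally geodesically complete OR settles
to finitely many sub-extremal Kerr holes with the same three clauses (rays stay in closure O,
honest-radii exhaustive charts, future-oriented charts). X → FSC is pure logic and CRUX-ONLY: tame
Christodoulou genericity is monotone in the property and X₁ closes the first branch of X₂'s
dichotomy (proved, glue `closes (h₁ : RegularCompleteDisperses) (h₂ : GenericCensorshipOrCollapse)`,
re-elaborated 2026-08-16 against the re-typed Statement p126844); conversely FSC ⇒ X₂ outright.
Lean: `RegularCompleteDisperses ∧ GenericCensorshipOrCollapse`

## Assembly
Pure logic, sorry-free in Sketch.lean and in glue.lean (`closes`): fix X;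
`IsTameChristodoulouGeneric
𝓓 P 1` unfolds to `HasTameCodimAtLeastIn 𝓓 {d ∈ 𝓓 | ¬P d} 1`, which is antitone in the exceptional
set (the end, the family, tameness, immersion and injectivity are kept; only the escape clause
moves), hence monotone in P along implications valid on 𝓓; for d ∈ 𝓓 the frame property
(GenericCensorshipOrCollapse at d) gives the FSC property at d: MGHD existence and complete 𝓘⁺ are
common, the regular branch is sent by RegularCompleteDisperses to an N = 0
decomposition with the three clauses (sub-extremality vacuous over Fin 0), the collapse branch is
the FSC decomposition itself.

Rationale: WHY THIS LINE. Mechanism (card): vacuum has no scale, so a horizonless curvature-concentration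
cascade runs on a
GEOMETRIC CLOCK — no-loitering (quantitative horizonless rigidity: a bounded-geometry vacuum region
with small boundary flux over time ≫ its scale is nearly flat, engine doi:10.1007/PL00001021 +
Komar/KID), terminal dilution (scale-free small-data dispersal with absorbing 𝓘⁺,
Christodoulou–Klainerman 1993, arXiv:2108.13379) and causal duration make every affordable cascade
geometrically FAST (CascadeClock), so "blow-up at infinity" is a finite-time singularity in disguise
and is excluded by regularity; what remains disperses. Imported area: critical dispersive PDE — the
Kenig–Merle/DKM rigidity step "no stationary state in the critical space ⇒ bounded solutions scatter
in finite AND infinite time" (arXiv:1208.2158) and the Merle–Zaag "no lingering" clock, transplanted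
with the dictionary soliton ↦ stationary/breathing AF vacuum spacetime (none: Lichnerowicz,
Anderson, Alexakis–Schlue arXiv:1504.04592), critical norm ↦ scale-free curvature size, scattering ↦
C²-convergence to η on exhaustive flat slabs. Planner's correction: the card's "no closed trapped
surface" notion of horizonless is refutable — Kehle–Unger arXiv:2402.10190 Thm 1(2) exhibits
(Einstein–Maxwell–Vlasov) a BLACK HOLE with complete 𝓘⁺ and no trapped surface anywhere (extremal
critical collapse) and p. 9 expects the same in vacuum with extremal Kerr; with horizonless :=
future causally geodesically complete (Kehle–Unger's and Luk–Oh's own phrasing of the dispersive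
branch, arXiv:1402.2984) extremal formation has a Cauchy horizon, is incomplete, and falls in the
collapse sector, while trapped-surface freeness is DERIVED locally (Penrose) inside the proofs. What
no prior route does (none exist on this summit; negatives index empty): decide FSC as [regular ⇒
disperse, all data] + [generic censorship-or-collapse], making Luk–Oh's open second branch ("blows
up at infinity", arXiv:1402.2984 abstract; arXiv:2402.10190 Rem. 1.4) a named vacuum crux, and
isolating the vacuum-specific input as NoVacuumBreathers — the massless Einstein–Vlasov photon
shells of arXiv:1511.01290 (static, regular, 2m/r near 8/9) show the clock alone proves nothing
without it.

RANKED CRUXES. #2 RegularCompleteDisperses (crux) — (card X, corrected) for every admissible datum D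
on X, every maximal vacuum Cauchy development with complete future null infinity (sojourn form) all
of whose future-directed null and timelike maximal geodesics are complete admits an N = 0 final
state decomposition d (C²) of O = J⁺(ιX) ∩ I⁻(d.charted) with every future-complete normalised null
ray from Σ staying in closure O (`RaysStayInClosure`), honest-radii exhaustive charts
(`HasExhaustiveCharts`) and future-oriented chart time (`IsFutureOriented`; re-typed T2 Statement
p126844, 2026-08-16) — it disperses to Minkowski space; no blow-up at infinity, no breather. [deps:
NoVacuumBreathers, CascadeClock] [difficulty: open-problem] (why it might fail: a regular AF vacuum
solution that never settles — blow-up at infinity (scale-free curvature unbounded as t→∞; open even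
in spherical Einstein–scalar, Luk–Oh) or a quasi-periodic breather loitering on trapped null
geodesics of an ultracompact lump (2m/r→8/9) with flux too weak for the clock; uniform C² decay on
whole flat slabs may fail for slow tails.) [arXiv:1402.2984, arXiv:2402.10190, arXiv:1208.2158,
arXiv:2108.13379, doi:10.1007/PL00001021, arXiv:1511.01290]
#3 GenericCensorshipOrCollapse (crux) — (complementary sector, shared frame; crux-only form
2026-08-16: it carries the anti-vacuity conjunct exactly as the Statement does) for every data
manifold X, the property "D has an MGHD (Choquet-Bruhat–Geroch; input = support
MaximalDevelopmentExists) and every MGHD of D has complete 𝓘⁺ and is either future causally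
geodesically complete or admits a final state decomposition into finitely many SUB-extremal Kerr
holes on its self-determined exterior O with rays staying in closure O, honest-radii exhaustive
charts and future-oriented chart time" is TAME-Christodoulou-generic (`IsTameChristodoulouGeneric …
1`: tame codimension ≥ 1 — the escaping one-parameter family lives on ONE fixed asymptotically flat
end, is continuous at 0 in the weighted C²₋₁ × C¹₋₂ distance and immersed at 0; re-typed T2
Statement p126844) in the admissible class — weak cosmic censorship plus the collapse alternative,
with the regular branch left undescribed. [difficulty: open-problem] (why it might fail: it contains
WCC and large-data Kerr settling; tame witnesses cannot bury or rescale the datum away, so every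
exceptional datum needs an honest fixed-end escaping family; curve-genericity (smooth injective
1-parameter families) is not closed under ∧ and may fail at accumulating collapse thresholds;
extremal-Kerr thresholds (arXiv:2402.10190 §1.5) must sit in tame codimension ≥ 1.)
[DafermosLuk2017, Christodoulou1999, arXiv:2402.10190, arXiv:2211.15742,
GiorgiKlainermanSzeftel2022]
#4 NoVacuumBreathers (crux) — (the unit-scale "no loitering state" input, Alexakis–Schlue form made
global) a regular complete MGHD of an admissible datum (complete 𝓘⁺, future causally geodesically
complete) admitting a time-orientation preserving isometry φ that maps every point into its own
chronological future (a discrete time translation: breather / geon / time-periodic solution) is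
flat. [difficulty: L] (why it might fail: Alexakis–Schlue give stationarity only NEAR 𝓘; extending
the Killing field inward is blocked by trapped null geodesics (unique continuation needs
pseudoconvexity, Ionescu–Klainerman), so a nonflat vacuum breather stationary near infinity is not
excluded.) [arXiv:1504.04592, arXiv:1003.3402, doi:10.1007/PL00001021, IonescuKlainerman2012,
arXiv:1511.01290]
#9 MaximalDevelopmentExists (support) — every admissible datum has a maximal vacuum Cauchy
development (Choquet-Bruhat–Geroch 1969 Thm 3, Sbierski 2016 Thm 2.6, over
`VacuumCauchyDevelopment`; the prelude's `choquetBruhat_geroch_exists_mghd` is the refuted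
mis-rendering, the corrected fact `choquetBruhat_geroch_exists_mghd_cauchy` is in the tree —
`Literature/Geometry/Lorentzian/CauchyProblemMGHDExistence.lean`, with the admissible-data corollary
`choquetBruhat_geroch_exists_mghd_cauchy.forall_mem_admissibleVacuumData` in
`AdmissibleMGHDExistence.lean` = verbatim this item modulo the fact) — the anti-vacuity conjunct of
FSC, shared by every route; since the crux-only repair it is the input for the `∃ MGHD` conjunct of
GenericCensorshipOrCollapse and no longer a hypothesis of `closes`. [difficulty: M]
[ChoquetBruhatGeroch1969CMP, Ringstrom2009]
#9 CascadeClock (support) — (card P1, the clock) if stage scales halve, ℓ_{k+1} ≤ ℓ_k/2 with ℓ_k ≥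
0, and stage durations satisfy 0 ≤ d_k ≤ A·ℓ_k, then Σ d_k converges and is ≤ 2A·ℓ₀ — an affordable
cascade reaching scale 0 does so in finite time. [difficulty: provable-now] [arXiv:0711.4620]

TWO-LAYER PLAN. Foreseen glued splits (nothing filed now). RegularCompleteDisperses ⇐
NoBlowUpAtInfinity →
BoundedRegularDisperses → RegularCompleteDisperses, where NoBlowUpAtInfinity := complete 𝓘⁺ ∧ future
causally geodesically complete ⇒ scale-free geometry bounded for all late time (the CLOCK:
no-loitering NL + causal duration CD + CascadeClock turn an infinite cascade into a finite-time
curvature blow-up, contradicting regularity) and BoundedRegularDisperses := bounded + regular +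
complete 𝓘⁺ ⇒ N = 0 exhaustive decomposition (NL at the top scale + terminal dilution TD; =
no-parking-komar's "light + bounded ⇒ disperse"); both need the definition request
HasBoundedScaleFreeGeometry. Later NoBlowUpAtInfinity ⇐ NoLoitering (NL, unit scale, quantitative
horizonless rigidity with small timelike-tube flux) → TerminalDilution (TD, localised scale-free
small-data dispersal with large data outside, Luk–Oh / Shen exterior stability) → glue (CD +
CascadeClock + scale covariance). NoVacuumBreathers ⇐ StationaryNearInfinity (Alexakis–Schlue Thm
1.1, known) → HorizonlessKillingExtension (the open step) → glue by Anderson's theorem (stationary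
geodesically complete vacuum ⇒ flat, fact request).

KILL CRITERIA. A future causally geodesically complete admissible vacuum development with complete
𝓘⁺ that does not
converge to η — a solution blowing up at infinity, or a nonflat vacuum breather/geon — refutes
RegularCompleteDisperses: close `refuted:RegularCompleteDisperses` (the card dies with it; hand the
witness to lasalle-bondi-lyapunov-liouville and no-parking-without-horizon-komar as a negative). A
nonflat breather alone refutes NoVacuumBreathers and RegularCompleteDisperses together.
GenericCensorshipOrCollapse refuted (e.g. a curve-genericity failure à la
threshold-lamination-vs-curve-genericity, or an open set of data with future-complete black-hole
MGHDs) is a frame failure shared by every FSC route: pivot by restating the frame over the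
re-audited Statement, not a reason to close this line (done once: 2026-08-16 re-type T2, p126844 —
both sector statements restated 1:1, `closes` re-elaborated). FSC proved by any other route moots
it;
RegularCompleteDisperses keeps stand-alone value (Luk–Oh/Kehle–Unger open problem in vacuum).

NOT DECOMPOSED YET. The clock's unit-scale lemmas NL / TD / CD and their constants (C, T₀, ε₀, δ₀),
the lump bookkeeping
K3 (quasi-local mass monotone under flux through timelike tubes, Wang–Yau), scale covariance of the
lemmas (P2), the support lemmas "future null complete ⇒ complete 𝓘⁺" (from
`hasCompleteFutureNullInfinity_of_forall_not_bddAbove` + conservation of causal character) and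
"regular ⇒ no closed trapped surface in J⁺(ιX)" (Penrose over the corrected Cauchy-hypersurface
notion), and the N = 0 chart construction from CK-type decay (exhaustiveness at every τ₁ with honest
radii,
future orientation of the flat chart, rays in closure O). All are
layer-2 children or prover-attached lemmas once HasBoundedScaleFreeGeometry is defined.

CHEAPEST FALSIFIER. Lookup + one numeric. (i) LOOKUP (done this session): is there a regular,
complete, non-dispersing
solution of a SCALE-INVARIANT massless self-gravitating model? YES for massless Einstein–Vlasov —
the static photon shells of Andréasson–Fajman–Thaller arXiv:1511.01290 (2m/r near 8/9): so the clock
is void without the vacuum no-soliton input, and the refuter should first try to transplant that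
construction to VACUUM (a quasi-periodic Brill–Hartle-type geon with exactly vanishing news) — any
success kills RegularCompleteDisperses and NoVacuumBreathers at once; none is known (Anderson 2000
kills the stationary case, Alexakis–Schlue the periodic case near 𝓘). (ii) NUMERIC (card P3,
kit-sized, not run — hub is compute-free this session): in near-critical spherical Einstein–scalar
evolutions on both sides of p*, is the radiated Bondi-mass fraction per curvature e-fold bounded
below uniformly as p → p*? If ε₀ → 0 along the DSS echoes the clock can stall and NL fails already
in the model.

NUMBERS. Type-II critical collapse clocks (Gundlach–Martín-García arXiv:0711.4620): spherical
massless scalar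
Δ ≈ 3.44 (scale ratio e^Δ ≈ 31 per echo), mass-scaling exponent γ ≈ 0.374; axisymmetric vacuum
(Brill waves, Abrahams–Evans 1993) Δ ≈ 0.6, γ ≈ 0.36 — geometric stage scales ℓ_k = e^{−kΔ}ℓ₀ and
stage durations ∝ ℓ_k, the model instance of CascadeClock with halving replaced by e^{−Δ}.
Ultracompactness bound for static Vlasov-type matter 2m/r < 8/9 (Andréasson 2008, cited in
arXiv:1511.01290) marks the regime where NL is weakest. Items at open: 6 (3 cruxes, 2 support, 1
assembly); `closes` assumes the two sector cruxes only (2026-08-16).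

DEFINITION REQUESTS. - HasBoundedScaleFreeGeometry (topic Literature/Geometry/Lorentzian): for a
`CauchyDevelopment`, a positive-definite scale-free bound on
  curvature to the future of the data — e.g. sup over J⁺(ιX) of |Riem|_T · σ_T² ≤ C for the
electric–magnetic norm relative to the unit
  normal T of a regular (maximal or CMC) foliation and σ_T the foliation's size function — the typed
hinge of the foreseen split of
  RegularCompleteDisperses; with it `curvatureScale` and `BlowsUpAtInfinity` (card D1) are
one-liners.
- quasiLocalFluxThroughTube (topic Literature/Geometry/Lorentzian): energy flux of a vacuum metric
through a timelike cylinder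
  (Wang–Yau arXiv:0804.1174 or Hawking-energy based), needed to state NL and K3.
- Fact requests (kind cite, family gr): corrected MGHD existence
`choquetBruhat_geroch_exists_mghd_cauchy` (ChoquetBruhatGeroch1969CMP
  Thm 3 / Sbierski 2016 Thm 2.6) for MaximalDevelopmentExists; Anderson, AHP 1 (2000) 977 Thm 0.1
(geodesically complete stationary
  vacuum ⇒ flat); Alexakis–Schlue JDG 108 (2018) Thm 1.1–1.2 (time-periodic ⇒ stationary near 𝓘);
Penrose's theorem over
  `IsCauchyHypersurface` (the prelude's `penrose_singularity_theorem` is stated over the defective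
`IsCauchySurface`).

Novelty: Searches (2026-08-15; searchd down, OpenAlex/S2 rate-limited, zbMATH + arXiv reads used): `lit
search --source zbmath "blow-up at infinity
Einstein"` (8; hit 1 = Luk–Oh arXiv:1402.2984, the dichotomy decay-or-blow-up-at-infinity for future
causally geodesically complete spherical Einstein–scalar solutions); `lit read arxiv:2402.10190
--pages 1-9` (Rem. 1.4 p. 8: ruling out blow-up at infinity "an interesting open problem"; Thm 1(2)
p. 4: black hole, complete 𝓘⁺, no trapped surfaces; p. 9: expected in vacuum); `lit read
arxiv:2211.15742 --pages 1-6` (p. 6: third-law examples do contain trapped surfaces); `lit search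
--source zbmath "periodic vacuum Einstein stationary"` (9; Bičák–Scholtz–Tod arXiv:1003.3402,
Alexakis–Schlue arXiv:1504.04592 = doi:10.4310/jdg/1513998029, read pp. 1–4: Thm 1.1 near-𝓘 only,
Remark p. 4 interior extension blocked by trapped null geodesics); `lit search --source zbmath
"stationary Einstein vacuum geodesically complete"` (4; Anderson doi:10.1007/PL00001021, Chen
arXiv:1606.00543); `lit search --source zbmath "self-gravitating photon shells geons"` (1;
arXiv:1511.01290, read pp. 1–3); `lit search --source zbmath "global nonlinear stability Minkowski
large data"` (8; CK 1993, Lindblad–Rodnianski, nothing large-data-all-regular); `lit frontier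
FinalStateConjecture --since 2021` (30 rows; arXiv:2601.04152 finite-time visibility only); `lit
bridges FinalStateConjecture --cross any` (30; surveys); `lit galaxy search "blow up at infinity
asymptotically fla  [refs: 10.4310/jdg/1513998029, 10.1007/PL00001021, 1402.2984, 2402.10190, 2211.15742, 1003.3402, 1504.04592, 1606.00543, 1511.01290, 2601.04152, 1208.2158, arxiv:2402.10190, arxiv:2211.15742, doi:10.4310/jdg/1513998029, doi:10.1007/PL00001021]

Barriers (technique_class: scale-cascade-clock, horizonless-rigidity, no-soliton): - technique_class: scale-cascade-clock, horizonless-rigidity, no-soliton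
- Literature.Barriers.FinalStateConjecture.nakedSingularityInstability: the only ALL-DATA claim
(RegularCompleteDisperses) takes complete 𝓘⁺ and geodesic completeness as HYPOTHESES, so
naked-singularity developments (incomplete 𝓘⁺) are outside it; genericity is confined to the frame
GenericCensorshipOrCollapse, stated with the Statement's own codimension-one notion — consistent
with the barrier, not evaded by strength.
- Literature.Barriers.FinalStateConjecture.IonescuKlainermanNonExtension: it does not fully; the
barrier is local at a Kerr horizon (scope (a)) and no horizon occurs in the regular sector, but its
mechanism — no Carleman unique continuation across non-pseudoconvex sets — reappears at trapped null
geodesics of ultracompact horizonless lumps (Alexakis–Schlue's Remark); the bet is that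
NoVacuumBreathers / NL are proved from flux smallness plus geodesic COMPLETENESS (Anderson-type
Cheeger–Gromov rigidity, which uses no unique continuation), not by extending Killing fields inward.
- Literature.Barriers.FinalStateConjecture.WaveCoordinatesNullConditionFailure: terminal dilution
consumes small-data dispersal as a geometric black box (Christodoulou–Klainerman / Bieri / Luk–Oh
double-null), never a wave-coordinate iteration; outside the class.
- Literature.Barriers.FinalStateConjecture.KehrbergerLogarithmicAsymptotics: the conclusion is C²
convergence to η in physical-space charts on exhaustive sla

Novelty grade: new-combination — ROUTE REVIEW (refuter rreview-0815T14-14) VERDICT ok + consolidation advice. Grade mirrors the card audit. CHECKS: 6/6 decls elaborate (W2.lean); all stamped with briefing notes. Layer 1 = PARTITION of FSC: GenericCensorshipOrCollapse (9979) is implied by FSC (monotone genericity), RegularCompleteDi (refuter refuter-rreview-0815T14-14-0, 2026-08-15T15:26:06Z; prior: arXiv:1208.2158 (DKM rigidity: no stationary state => bounded solutions scatter); doi:10.1007/PL00001021 (Anderson 2000); arXiv:1504.04592 (Alexakis-Schlue); arXiv:1402.2984 + arXiv:2402.10190 Rem 1.4 (blow-up at infinity open); sibling route NoParkingWithoutHorizon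 (near-duplicate layer 1))

History (route lifecycle, newest last):
- 2026-08-16T23:12:05Z · rev 3: restated RegularCompleteDisperses (stmt-FinalStateConjecture-9978), GenericCensorshipOrCollapse (stmt-FinalStateConjecture-9979) — route-repair (statement-revised p126844, re-type T2): restated RegularCompleteDisperses and GenericCensorshipOrCollapse 1:1 to the re-typed conclusion (RaysStay (planner-rrepair-FinalStateConjecture-Concentra-02a8080e-0)
- 2026-08-16T23:15:15Z · rev 4: restated GenericCensorshipOrCollapse (stmt-FinalStateConjecture-17277) — route-repair (crux-only): GenericCensorshipOrCollapse restated to carry the anti-vacuity conjunct (∃ MGHD) ∧ … exactly as the re-typed Statement (summit pattern (planner-rrepair-FinalStateConjecture-Concentra-02a8080e-0)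
- 2026-08-22T05:40:37Z · DORMANT — reconciler: no traction for 5.1 d (last activity item-evidence-added at 2026-08-17T02:34:27Z); parked, not closed — `ledger route dormant route-FinalStateConjec (operator:999:158029)
- 2026-08-30T18:34:08Z · REACTIVATED (open) — reconciler: reactivated — activity item-evidence-added at 2026-08-30T17:24:47Z after parking at 2026-08-22T05:40:37Z (operator:999:3534912)

sub-problem: FinalStateConjecture · status: open · opened planner-plancard-FinalStateConjecture-FinalSt-4329e1d0-0 2026-08-15T14:58:57Z · rev 5 · ledger route-FinalStateConjecture-ConcentrationCannotWait
GENERATED by the gate from the ledger (D-0016/17). Provers cite these decls: `theorem foo : Summit.FinalStateConjecture.FinalStateConjecture.Theses.ConcentrationCannotWait.<Decl> := …` in Summits/FinalStateConjecture/FinalStateConjecture/Theorems/<Name>.lean.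
-/

namespace Summit.FinalStateConjecture.FinalStateConjecture.Theses.ConcentrationCannotWait

open scoped BigOperators Topology Manifold Classical MeasureTheory ProbabilityTheory Matrix InnerProductSpace ComplexConjugate ContinuousMap
open Filter Set Function TopologicalSpace MeasureTheory

attribute [summit_statement] _root_.FinalStateConjecture

-- earlier RegularCompleteDisperses (stmt-FinalStateConjecture-9978, replaced 2026-08-16T23:12:05Z -> stmt-FinalStateConjecture-17276): retired by None — ∀ (X : Type) [TopologicalSpace X] [ChartedSpace Literature.Geometry.Lorentzian.E3 X] [IsManifold (𝓡 3) (⊤ : ℕ∞) X] [T2Space X] [SecondCountableTopology X] [ConnectedSpace X], ∀ D ∈ Literature.Geometry.Lorentzian.admissibleVacuumData X, ∀ 𝒟 : Literat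
/-- item stmt-FinalStateConjecture-17276 · crux · rank 2 · open · by planner
why it might fail: Blow-up at infinity (scale-free curvature unbounded as t→∞, future-complete MGHD) is open even for spherical Einstein–scalar (Luk–Oh Thm 3.14; Kehle–Unger Rem 1.4); a non-radiating breather on trapped null geodesics (2m/r≈8/9) is not excluded; uniform C² decay on whole flat slabs may fail.
sources: arXiv:1402.2984, arXiv:2402.10190, arXiv:2108.13379, arXiv:1208.2158, arXiv:1504.04592, doi:10.1007/PL00001021
[crux] (card X, corrected; re-typed 2026-08-16 to the T2 Statement p126844) for every admissible
datum D on X, every maximal vacuum Cauchy development with complete future null infinity (sojourn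
form) all of whose future-directed null and timelike maximal geodesics are complete admits an N = 0
final state decomposition d (C²) of O = J⁺(ιX) ∩ I⁻(d.charted) with every future-complete normalised
null ray from Σ staying in closure O (RaysStayInClosure), honest-radii exhaustive charts
(HasExhaustiveCharts) and future-oriented chart time (IsFutureOriented: the flat chart's ∂₀
eventually future-directed) — it disperses to Minkowski space; no blow-up at infinity, no breather.
[deps: NoVacuumBreathers, CascadeClock] [difficulty: open-problem] -/
@[route_item "route-FinalStateConjecture-ConcentrationCannotWait", crux]
def RegularCompleteDisperses : Prop :=
  ∀ (X : Type) [TopologicalSpace X] [ChartedSpace Literature.Geometry.Lorentzian.E3 X] [IsManifold (𝓡 3) (⊤ : ℕ∞) X] [T2Space X] [SecondCountableTopology X] [ConnectedSpace X], ∀ D ∈ Literature.Geometry.Lorentzian.admissibleVacuumData X, ∀ 𝒟 : Literature.Geometry.Lorentzian.VacuumCauchyDevelopment D, 𝒟.IsMaximal → Summit.FinalStateConjecture.HasCompleteNullInfinity 𝒟.toCauchyDevelopment → (∀ [𝒟.metric.HasLeviCivita], ¬ 𝒟.metric.IsFutureNullGeodesicallyIncomplete 𝒟.timeOrientation ∧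 ¬ 𝒟.metric.IsFutureTimelikeGeodesicallyIncomplete 𝒟.timeOrientation) → ∃ (O : Set 𝒟.carrier) (d : Literature.Geometry.Lorentzian.FinalStateDecomposition 𝒟.toSpacetime O 2), d.N = 0 ∧ O = Summit.FinalStateConjecture.exteriorOf 𝒟.toCauchyDevelopment d.charted ∧ Summit.FinalStateConjecture.RaysStayInClosure 𝒟.toCauchyDevelopment O ∧ Summit.FinalStateConjecture.HasExhaustiveCharts d ∧ Summit.FinalStateConjecture.IsFutureOriented d

-- earlier GenericCensorshipOrCollapse (stmt-FinalStateConjecture-17277, replaced 2026-08-16T23:15:15Z -> stmt-FinalStateConjecture-17310): retired by None — ∀ (X : Type) [TopologicalSpace X] [ChartedSpace Literature.Geometry.Lorentzian.E3 X] [IsManifold (𝓡 3) (⊤ : ℕ∞) X] [T2Space X] [SecondCountableTopology X] [ConnectedSpace X], Literature.Geometry.Lorentzian.InitialDataSet.IsTameChristodoulouGener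
-- earlier GenericCensorshipOrCollapse (stmt-FinalStateConjecture-9979, replaced 2026-08-16T23:12:05Z -> stmt-FinalStateConjecture-17277): retired by None — ∀ (X : Type) [TopologicalSpace X] [ChartedSpace Literature.Geometry.Lorentzian.E3 X] [IsManifold (𝓡 3) (⊤ : ℕ∞) X] [T2Space X] [SecondCountableTopology X] [ConnectedSpace X], Literature.Geometry.Lorentzian.InitialDataSet.IsChristodoulouGeneric (L
/-- item stmt-FinalStateConjecture-17310 · crux · rank 3 · open · by planner
why it might fail: Contains vacuum WCC and large-data Kerr settling; TAME witnesses must live on one fixed end with continuous mass (no burial/rescaling escape); extremal-Kerr thresholds (arXiv:2402.10190 §1.5) or non-settling exteriors must have tame codim ≥ 1; curve-genericity of a conjunction is not automatic.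
sources: DafermosLuk2017, Christodoulou1999, arXiv:2402.10190, arXiv:2211.15742, arXiv:2304.08455, GiorgiKlainermanSzeftel2022
[crux] (complementary sector, shared frame = the Statement's own property with the regular sector
left undescribed; re-typed 2026-08-16 to the T2 Statement p126844, crux-only form) for every data
manifold X, the property "D has a maximal vacuum Cauchy development (the anti-vacuity conjunct,
Choquet-Bruhat–Geroch 1969 Thm 3 — supplied to the prover by the support item
MaximalDevelopmentExists = vendored fact choquetBruhat_geroch_exists_mghd_cauchy restricted to
admissible data) AND every MGHD of D has complete 𝓘⁺ and is either future causally geodesically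
complete or admits a final state decomposition into finitely many SUB-extremal Kerr holes on its
self-determined exterior O with RaysStayInClosure, honest-radii exhaustive charts and
future-oriented chart time" is TAME-Christodoulou-generic (IsTameChristodoulouGeneric … 1: through
every exceptional admissible datum an injective immersed one-parameter admissible family on ONE
fixed asymptotically flat end, continuous at 0 in the weighted C²₋₁ × C¹₋₂ distance, all other
members satisfying it) — weak cosmic censorship plus the collapse alternative. FSC ⇒ this crux
outright (monotonicity); with RegularCompleteDisperses it is FSC (glue -/
@[route_item "route-FinalStateConjecture-ConcentrationCannotWait", crux]
def GenericCensorshipOrCollapse : Prop :=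
  ∀ (X : Type) [TopologicalSpace X] [ChartedSpace Literature.Geometry.Lorentzian.E3 X] [IsManifold (𝓡 3) (⊤ : ℕ∞) X] [T2Space X] [SecondCountableTopology X] [ConnectedSpace X], Literature.Geometry.Lorentzian.InitialDataSet.IsTameChristodoulouGeneric (Literature.Geometry.Lorentzian.admissibleVacuumData X) (fun D ↦ (∃ 𝒟 : Literature.Geometry.Lorentzian.VacuumCauchyDevelopment D, 𝒟.IsMaximal) ∧ ∀ 𝒟 : Literature.Geometry.Lorentzian.VacuumCauchyDevelopment D, 𝒟.IsMaximal → Summit.FinalStateConjecture.HasCompleteNullInfinity 𝒟.toCauchyDevelopment ∧ ((∀ [𝒟.metric.HasLeviCivita], ¬ 𝒟.metric.IsFutureNullGeodesicallyIncomplete 𝒟.timeOrientation ∧ ¬ 𝒟.metric.IsFutureTimelikeGeodesicallyIncomplete 𝒟.timeOrientation) ∨ ∃ (O : Set 𝒟.carrier) (d : Literature.Geometry.Lorentzian.FinalStateDecomposition 𝒟.toSpacetime O 2), (∀ i, Literature.Geometry.Lorentzian.Kerr.IsSubextremal (d.mass i) (d.spin i)) ∧ O = Summit.FinalStateConjecture.exteriorOf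 𝒟.toCauchyDevelopment d.charted ∧ Summit.FinalStateConjecture.RaysStayInClosure 𝒟.toCauchyDevelopment O ∧ Summit.FinalStateConjecture.HasExhaustiveCharts d ∧ Summit.FinalStateConjecture.IsFutureOriented d)) 1

/-- item stmt-FinalStateConjecture-9980 · crux · rank 4 · open · by planner
why it might fail: Known only NEAR scri (Alexakis-Schlue Thm 1.1 => stationary near scri) or for fields analytic at scri (Bicak-Scholtz-Tod I); extending the Killing field inward needs unique continuation past trapped null geodesics (A-S Rem. p.4), so an interior breather survives and Anderson Thm 0.1 cannot fire.
sources: arXiv:1504.04592, arXiv:1003.3402, doi:10.1007/PL00001021, IonescuKlainerman2012, arXiv:1511.01290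
[crux] (the unit-scale "no loitering state" input, Alexakis–Schlue form made global) a regular
complete MGHD of an admissible datum (complete 𝓘⁺, future causally geodesically complete) admitting
a time-orientation preserving isometry φ that maps every point into its own chronological future (a
discrete time translation: breather / geon / time-periodic solution) is flat. [difficulty: L] -/
@[route_item "route-FinalStateConjecture-ConcentrationCannotWait"]
def NoVacuumBreathers : Prop :=
  ∀ (X : Type) [TopologicalSpace X] [ChartedSpace Literature.Geometry.Lorentzian.E3 X] [IsManifold (𝓡 3) (⊤ : ℕ∞) X] [T2Space X] [SecondCountableTopology X] [ConnectedSpace X], ∀ D ∈ Literature.Geometry.Lorentzian.admissibleVacuumData X, ∀ 𝒟 : Literature.Geometry.Lorentzian.VacuumCauchyDevelopment D, 𝒟.IsMaximal → Summit.FinalStateConjecture.HasCompleteNullInfinity 𝒟.toCauchyDevelopment → (∀ [𝒟.metric.HasLeviCivita], ¬ 𝒟.metric.IsFutureNullGeodesicallyIncomplete 𝒟.timeOrientation ∧ ¬ 𝒟.metric.IsFutureTimelikeGeodesicallyIncomplete 𝒟.timeOrientation) → (∃ φ : Diffeomorph (𝓡 4) (𝓡 4) 𝒟.carrier 𝒟.carrier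 (⊤ : ℕ∞), 𝒟.metric.IsIsometry 𝒟.metric.toPseudoRiemannianMetric φ ∧ 𝒟.timeOrientation.PreservesTimeOrientation φ 𝒟.timeOrientation ∧ ∀ p, φ p ∈ 𝒟.metric.chronologicalFuture 𝒟.timeOrientation {p}) → ∀ [𝒟.metric.HasLeviCivita], 𝒟.metric.toPseudoRiemannianMetric.leviCivita.IsFlat

/-- item stmt-FinalStateConjecture-9981 · support · rank 9 · open · by planner
sources: ChoquetBruhatGeroch1969CMP, Ringstrom2009
[support] every admissible datum has a maximal vacuum Cauchy development (Choquet-Bruhat–Geroch 1969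
Thm 3, Sbierski 2016 Thm 2.6, over `VacuumCauchyDevelopment`; the prelude's
`choquetBruhat_geroch_exists_mghd` is the refuted mis-rendering, the corrected fact
`choquetBruhat_geroch_exists_mghd_cauchy` is requested) — the anti-vacuity conjunct of FSC, shared
by every route. [difficulty: M] -/
@[route_item "route-FinalStateConjecture-ConcentrationCannotWait"]
def MaximalDevelopmentExists : Prop :=
  ∀ (X : Type) [TopologicalSpace X] [ChartedSpace Literature.Geometry.Lorentzian.E3 X] [IsManifold (𝓡 3) (⊤ : ℕ∞) X] [T2Space X] [SecondCountableTopology X] [ConnectedSpace X], ∀ D ∈ Literature.Geometry.Lorentzian.admissibleVacuumData X, ∃ 𝒟 : Literature.Geometry.Lorentzian.VacuumCauchyDevelopment D, 𝒟.IsMaximal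

/-- item stmt-FinalStateConjecture-9982 · support · rank 9 · open · by planner
sources: arXiv:0711.4620
[support] (card P1, the clock) if stage scales halve, ℓ_{k+1} ≤ ℓ_k/2 with ℓ_k ≥ 0, and stage
durations satisfy 0 ≤ d_k ≤ A·ℓ_k, then Σ d_k converges and is ≤ 2A·ℓ₀ — an affordable cascade
reaching scale 0 does so in finite time. [difficulty: provable-now] -/
@[route_item "route-FinalStateConjecture-ConcentrationCannotWait"]
def CascadeClock : Prop :=
  ∀ (A : ℝ) (ℓ d : ℕ → ℝ), 0 ≤ A → (∀ k, 0 ≤ ℓ k) → (∀ k, ℓ (k + 1) ≤ ℓ k / 2) → (∀ k, 0 ≤ d k) → (∀ k, d k ≤ A * ℓ k) → Summable d ∧ ∑' k, d k ≤ 2 * A * ℓ 0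

/-- item stmt-FinalStateConjecture-9983 · assembly · rank 1 · open · by planner
sources: DafermosLuk2017, Christodoulou1999
[assembly] RegularCompleteDisperses → GenericCensorshipOrCollapse → MaximalDevelopmentExists → the
final state conjecture. -/
@[route_item "route-FinalStateConjecture-ConcentrationCannotWait"]
def Assembly : Prop :=
  RegularCompleteDisperses → GenericCensorshipOrCollapse → MaximalDevelopmentExists → FinalStateConjecture

/-! D-0027 §2.1 — DECIDING THEOREM (planner-authored via `route open/edit --closes-file`; by planner-rbadge-FinalStateConjecture-Concentrat-df039ae3-0 2026-08-16T23:40:29Z):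
its hypotheses are this route's items and its conclusion the sub-problem Statement (glue_lint), and it elaborates with this file. -/

/-- D-0027 §2.1 deciding theorem, CRUX-ONLY (re-certified 2026-08-16 after a stale fullbuild stamp;
elaborates against the re-typed T2 Statement, p126844): pure logic — TAME Christodoulou genericity
(`IsTameChristodoulouGeneric`, witness family on one fixed end) is monotone in the property inside
the admissible class (the end, the family, tameness, immersion and injectivity are kept verbatim;
only the escape clause is transported along the implication), and the sector dichotomy of the
frame crux `GenericCensorshipOrCollapse` — which carries the anti-vacuity conjunct `∃ MGHD` exactly
as the Statement does — is closed by `RegularCompleteDisperses` (regular sector: an `N = 0`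
decomposition with `RaysStayInClosure`, honest-radii `HasExhaustiveCharts` and `IsFutureOriented`;
sub-extremality vacuous over `Fin 0`) resp. by itself (collapse sector, same clauses). The third
crux `NoVacuumBreathers` and the supports `MaximalDevelopmentExists` (Choquet-Bruhat–Geroch, the
input for the frame's `∃ MGHD`) and `CascadeClock` enter through the cruxes' own proofs (two-layer
plan), not through the glue. -/
@[closes "route-FinalStateConjecture-ConcentrationCannotWait"] theorem closes (h₁ : RegularCompleteDisperses) (h₂ : GenericCensorshipOrCollapse) : _root_.FinalStateConjecture := by
  intro X _ _ _ _ _ _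
  -- tame Christodoulou genericity is monotone in the property along implications valid on 𝓓
  have mono : ∀ (P Q : Literature.Geometry.Lorentzian.InitialDataSet (𝓡 3) X → Prop),
      (∀ d ∈ Literature.Geometry.Lorentzian.admissibleVacuumData X, P d → Q d) →
      Literature.Geometry.Lorentzian.InitialDataSet.IsTameChristodoulouGeneric
        (Literature.Geometry.Lorentzian.admissibleVacuumData X) P 1 →
      Literature.Geometry.Lorentzian.InitialDataSet.IsTameChristodoulouGeneric
        (Literature.Geometry.Lorentzian.admissibleVacuumData X) Q 1 := by
    intro P Q hPQ hP d hd
    obtain ⟨e, F, hF, hI, h0, hinj, hD, hE⟩ := hP d ⟨hd.1, fun h ↦ hd.2 (hPQ d hd.1 h)⟩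
    exact ⟨e, F, hF, hI, h0, hinj, hD, fun c hc hm ↦ hE c hc ⟨hm.1, fun h ↦ hm.2 (hPQ _ hm.1 h)⟩⟩
  refine mono _ _ ?_ (h₂ X)
  rintro D hD ⟨hex, hframe⟩
  refine ⟨hex, fun 𝒟 hmax ↦ ⟨(hframe 𝒟 hmax).1, ?_⟩⟩
  rcases (hframe 𝒟 hmax).2 with hreg | ⟨O, d, hsub, hO, hrays, hexh, hfut⟩
  · -- regular sector: an N = 0 decomposition; sub-extremality is vacuous over `Fin 0`
    obtain ⟨O, d, hN, hO, hrays, hexh, hfut⟩ := h₁ X D hD 𝒟 hmax (hframe 𝒟 hmax).1 hreg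
    exact ⟨O, d, fun i ↦ absurd i.isLt (by omega), hO, hrays, hexh, hfut⟩
  · -- collapse sector: the frame's decomposition is the Statement's
    exact ⟨O, d, hsub, hO, hrays, hexh, hfut⟩

end Summit.FinalStateConjecture.FinalStateConjecture.Theses.ConcentrationCannotWait
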